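import Summits.HodgeConjecture.HodgeConjecture.Theorems.Ring2BindersAbelianSchemeVHCPrimitiveMiddleFamily
import Summits.HodgeConjecture.HodgeConjecture.Theorems.Ring2BindersAbelianSchemeVHCPrimitive
import HarnessLib

/-!
# Ring 2 — binder seat b02 (Hodge ladder stage 3): row b02 `AbelianSchemeVHC` IS the variational Hodge conjecture for
# fibrewise LEFSCHETZ-PRIMITIVE classes of the MIDDLE degree on abelian schemes of even relative dimension `≥ 4`,
# modulo the print residual only — the diagonal and the primitive normal forms meet

HONEST FRAMING: research route conditional on HC_CM; not a corollary; Q11.4-sentence-2 already refuted in dim ≥ 3.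

Cell `pub-hodge-ring2`, binder seat `ring2-b02`, row b02 of `BINDER-OWNERS.md` (`Ring2.Hypotheses.AbelianSchemeVHC`,
`Theorems/Ring2Hypotheses.lean`; OPEN, print-equivalent to `HC_AV`, nothing to discharge). `HC_CM`
(`Theses.RankFourFaces.CMAbelianHodge`) does not occur below; nothing here is a case of the Hodge conjecture; no `sorry`, no
definition, no NEW Literature fact, no node; «10 · 0» untouched.

WHAT THIS PART SETTLES. Row b02 had two side-by-side normal forms modulo the print residual c20 (Raynaud 1970, booked):
the DIAGONAL `(2q, q)`, `q ≥ 2` — all fibrewise rational `(q,q)` classes of the middle degree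
(`Ring2BindersAbelianSchemeVHCMiddleDegree.lean`, p249658) — and the fibrewise LEFSCHETZ-PRIMITIVE classes of codimension
`2 ≤ p ≤ n/2` on even relative dimension `n ≥ 4` (`Ring2BindersAbelianSchemeVHCPrimitive.lean`, p251474), exactly as AbelianAll's
parts XV / XIV for `HC_AV`. Their INTERSECTION — fibrewise-primitive classes of the MIDDLE degree only — is reached here, by the
induction on the Lefschetz defect of `Ring2BindersAbelianSchemeVHCPrimitiveMiddleFamily.lean` (pad by one elliptic curve per unit
of defect; the two-term primitive lift `L_{pr₁^*K}(pr₁^*W) - (r+1) · L_{pr₂^*K_E}(pr₁^*W)`, a Clebsch–Gordan lowest-weight vector):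

* §1 **`AbelianSchemeVHCPrimitiveMiddle[From[g]]`** (file-local notations: the body of `Ring2.Hypotheses.AbelianSchemeVHC` with a
  global class `K` polarising every fibre and the binders `2 ≤ p`, `2 * p = n`, `W|_{𝒳_s} ∈ P^{2p}(𝒳_s, K|) = ker L_{K|}` inserted;
  `g ≤ n`), restrictions from row b02 / from the primitive part's forms / from the diagonal form (all fact-free), and the
  consequences of the defect induction: **`abelianSchemeVHCPrimitiveEvenFrom_of_primitiveMiddleFrom`**
  (`PrimitiveMiddleFrom[g] ⟹ PrimitiveEvenFrom[g]`, every carrier), **`abelianSchemeVHCPrimitive_of_primitiveMiddle`**,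
  **`map_fiberι_mem_algebraicClasses_of_abelianSchemeVHCPrimitiveMiddleFrom`** (the primitive-middle form from `g` on gives the
  conclusion of row b02 on EVERY carrier of relative dimension `≥ g` with quasi-projective total space over a smooth irreducible
  quasi-projective base, every codimension — FACT-FREE), and the germ form `OneParameterAbelianSchemeVHCGerm`, FACT-FREE.
* §2 **THE BINDER**: `AbelianSchemeVHC ⟺ AbelianSchemeVHCPrimitiveMiddle ⟺ AbelianSchemeVHCPrimitiveMiddleFrom[4]` modulo N97 / c20
  (`raynaud1970_abelianScheme_section_projective`, used in `←` only); `⟺ AbelianSchemeVHCPrimitiveMiddleFrom[g+1]` granted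
  `HCUpToDim g`, so `⟺ AbelianSchemeVHCPrimitiveMiddleFrom[6]` modulo {c20, c9 Moonen–Zarhin, c28 Markman}; the diagonal form
  `MiddleDegreeFrom[4]`, the primitive form `PrimitiveEvenFrom[4]` and their intersection `PrimitiveMiddleFrom[4]` pairwise equivalent
  modulo c20; and `HC_AV ⟺ AbelianSchemeVHCPrimitiveMiddleFrom[4]` modulo {c11, c12, c20}, no `HC_CM`.
  FIRST CELL WITH CONTENT: families of abelian FOURFOLDS, `p = 2`, classes `W` with `W|_{𝒳_s} ∈ P⁴(𝒳_s, K|) = ker (L_{K|} : H⁴ → H⁶)`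
  at every `s`; modulo {c9, c28} the single cell `(6, 3)` with `W|_{𝒳_s} ∈ P⁶(𝒳_s, K|) = ker (L_{K|} : H⁶ → H⁸)`.

What is NOT claimed: any case of `AbelianSchemeVHC` or of HC; anything about `HC_CM`; the residual (N97 / c20 and the class targets
c9, c11, c12, c28 are HYPOTHESES wherever used, never asserted); the single-variety normal form of `HC_AV` by primitive middle classes
(AbelianAll's XIV/XV are the statements of record; the lift part would serve it). Row b02 stays OPEN ≡ `HC_AV` modulo print.
Presearch (this session): the classical reduction of HC to primitive middle-dimensional classes (Lefschetz; Kerr–Pearlstein §3.1,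
Thm. 32: `X × ℙʳ` and hyperplane sections) leaves the class of abelian varieties; the abelian-internal two-term lift and its
variational form were located on no held page (corpus hybrid + galaxy) — certification by assembly, nothing new to cite.

References: [Grothendieck1966] footnote 13; [CharlesSchnell2014Notes] Conj. 11.3.1, Prop. 11.3.5, Cor. 11.3.6, Prop. 11.3.11;
[VoisinHodgeI2002] Def. 6.24, Thm. 6.25, Cor. 6.26, Rem. 6.27, §7.1.2, Thm. 11.30; [VoisinHodgeII2003] Lemma 4.17, Thm. 4.18,
Prop. 9.20, §10.2.3; [Kleiman1968AlgebraicCycles] Thm. 2.9, Thm. 2A11; [Andre1996Motifs] §1.1, §1.3, §6.3; [KerrPearlstein2011] §3.1,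
Thm. 32; [BrosnanFangNiePearlstein2009] §6 Lemma 48; [Lieberman1968] main theorem; [GortzWedhorn2023] Thm. 27.291;
[LaurentSchroer2023] Prop. 4.3; [Raynaud1970] XI 1.4 (not held, acq-09263); [MoonenZarhin1999LowDim] Thms. 0.1–0.2;
[Markman2025SecantWeil] Cor. 1.6.1 (unrefereed); [Markman2025SurveySecant] Cor. 1.3 (unrefereed).
-/

-- every declaration of this problem lives in `Summit.HodgeConjecture.HodgeConjecture.…` (summit = sub-problem);
-- namespace `…Ring2.Binders` = the binder seats of the cell's Hodge-ladder stage 3 (`BINDER-OWNERS.md`)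
set_option linter.dupNamespace false

noncomputable section

open CategoryTheory CategoryTheory.Limits AlgebraicGeometry Topology MonoidalCategory CartesianMonoidalCategory
open Literature.AlgebraicGeometry Literature.AlgebraicGeometry.Motives
open Literature.AlgebraicGeometry.HodgeTheory
open Literature.AlgebraicGeometry.Andre1996 (andre1996_cmAnchoredPencil andre1996_cmHodgeClasses_algebraicallyAnchoredPencils)

namespace Summit.HodgeConjecture.HodgeConjecture.Ring2.Binders

open Summit.HodgeConjecture.HodgeConjecture.Ring2.Hypotheses
open Summit.HodgeConjecture.HodgeConjecture.Ring2.ClassTargets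

/-! ## §1 The graded statements (file-local notations; nothing is defined or asserted) and the consequences of the defect induction -/

section Binder

variable {𝒳 S : SchemeOver ℂ}

/-- **Row b02 restricted to fibrewise LEFSCHETZ-PRIMITIVE classes of the MIDDLE degree** (file-local notation; symbol for symbol
the body of `Ring2.Hypotheses.AbelianSchemeVHC` with a global class `K` polarising every fibre and the binders `2 ≤ p`, `2 * p = n`,
`W| ∈ primitiveClasses (K|) n (2p)` inserted — on a fibre of dimension `2p` that is `W|_{𝒳_s} ∈ P^{2p}(𝒳_s, K|) = ker (L_{K|} :
H^{2p} → H^{2p+2})`). -/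
local notation3 (prettyPrint := false) "AbelianSchemeVHCPrimitiveMiddle" =>
  ∀ ⦃n : ℕ⦄ ⦃𝒳 S : SchemeOver ℂ⦄ (f : 𝒳 ⟶ S), IsSmoothProjectiveFamily f n → IrreducibleSpace S.left →
    AlgebraicGeometry.Smooth S.hom →
    (∀ s : ComplexPoints S, ∃ A' : AbelianVariety ℂ, A'.dim = n ∧ Nonempty (A'.X ≅ fiberOver f s)) →
    ∀ (K : complexBetti 𝒳 2),
      (∀ s : ComplexPoints S, IsPolarizationClass n (fiberOver f s) (complexBetti.map (fiberι f s) 2 K)) →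
    ∀ (p : ℕ), 2 ≤ p → 2 * p = n → ∀ (W : complexBetti 𝒳 (2 * p)),
      (∀ s : ComplexPoints S, IsRationalClass (complexBetti.map (fiberι f s) (2 * p) W) ∧
        IsOfHodgeType n (fiberOver f s) (2 * p) p p (complexBetti.map (fiberι f s) (2 * p) W)) →
      (∀ s : ComplexPoints S, complexBetti.map (fiberι f s) (2 * p) W ∈
        primitiveClasses (complexBetti.map (fiberι f s) 2 K) n (2 * p)) →
      (∃ s₀ : ComplexPoints S,
        complexBetti.map (fiberι f s₀) (2 * p) W ∈ algebraicClasses (fiberOver f s₀) p) →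
      ∀ s : ComplexPoints S, complexBetti.map (fiberι f s) (2 * p) W ∈ algebraicClasses (fiberOver f s) p

/-- The same from relative dimension `g` on (file-local notation; the binder `g ≤ n` inserted): the cells `(2q, q)`, `2q ≥ g`,
restricted to fibrewise-primitive classes. -/
local notation3 (prettyPrint := false) "AbelianSchemeVHCPrimitiveMiddleFrom[" g "]" =>
  ∀ ⦃n : ℕ⦄ ⦃𝒳 S : SchemeOver ℂ⦄ (f : 𝒳 ⟶ S), IsSmoothProjectiveFamily f n → g ≤ n → IrreducibleSpace S.left →
    AlgebraicGeometry.Smooth S.hom →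
    (∀ s : ComplexPoints S, ∃ A' : AbelianVariety ℂ, A'.dim = n ∧ Nonempty (A'.X ≅ fiberOver f s)) →
    ∀ (K : complexBetti 𝒳 2),
      (∀ s : ComplexPoints S, IsPolarizationClass n (fiberOver f s) (complexBetti.map (fiberι f s) 2 K)) →
    ∀ (p : ℕ), 2 ≤ p → 2 * p = n → ∀ (W : complexBetti 𝒳 (2 * p)),
      (∀ s : ComplexPoints S, IsRationalClass (complexBetti.map (fiberι f s) (2 * p) W) ∧
        IsOfHodgeType n (fiberOver f s) (2 * p) p p (complexBetti.map (fiberι f s) (2 * p) W)) →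
      (∀ s : ComplexPoints S, complexBetti.map (fiberι f s) (2 * p) W ∈
        primitiveClasses (complexBetti.map (fiberι f s) 2 K) n (2 * p)) →
      (∃ s₀ : ComplexPoints S,
        complexBetti.map (fiberι f s₀) (2 * p) W ∈ algebraicClasses (fiberOver f s₀) p) →
      ∀ s : ComplexPoints S, complexBetti.map (fiberι f s) (2 * p) W ∈ algebraicClasses (fiberOver f s) p

/-- The primitive part's `AbelianSchemeVHCPrimitive` (file-local notation, verbatim `Ring2BindersAbelianSchemeVHCPrimitive.lean`: row
b02 restricted to fibrewise-primitive classes of codimension `2 ≤ p ≤ n/2`, any relative dimension), so that its lemmas are consumed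
by name. -/
local notation3 (prettyPrint := false) "AbelianSchemeVHCPrimitive" =>
  ∀ ⦃n : ℕ⦄ ⦃𝒳 S : SchemeOver ℂ⦄ (f : 𝒳 ⟶ S), IsSmoothProjectiveFamily f n → IrreducibleSpace S.left →
    AlgebraicGeometry.Smooth S.hom →
    (∀ s : ComplexPoints S, ∃ A' : AbelianVariety ℂ, A'.dim = n ∧ Nonempty (A'.X ≅ fiberOver f s)) →
    ∀ (K : complexBetti 𝒳 2),
      (∀ s : ComplexPoints S, IsPolarizationClass n (fiberOver f s) (complexBetti.map (fiberι f s) 2 K)) →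
    ∀ (p : ℕ), 2 ≤ p → 2 * p ≤ n → ∀ (W : complexBetti 𝒳 (2 * p)),
      (∀ s : ComplexPoints S, IsRationalClass (complexBetti.map (fiberι f s) (2 * p) W) ∧
        IsOfHodgeType n (fiberOver f s) (2 * p) p p (complexBetti.map (fiberι f s) (2 * p) W)) →
      (∀ s : ComplexPoints S, complexBetti.map (fiberι f s) (2 * p) W ∈
        primitiveClasses (complexBetti.map (fiberι f s) 2 K) n (2 * p)) →
      (∃ s₀ : ComplexPoints S,
        complexBetti.map (fiberι f s₀) (2 * p) W ∈ algebraicClasses (fiberOver f s₀) p) →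
      ∀ s : ComplexPoints S, complexBetti.map (fiberι f s) (2 * p) W ∈ algebraicClasses (fiberOver f s) p

/-- The primitive part's `AbelianSchemeVHCPrimitiveEvenFrom[g]` (file-local notation, verbatim: binders `g ≤ n`, `Even n`,
`2 ≤ p ≤ n/2`, fibrewise primitive), consumed by name. -/
local notation3 (prettyPrint := false) "AbelianSchemeVHCPrimitiveEvenFrom[" g "]" =>
  ∀ ⦃n : ℕ⦄ ⦃𝒳 S : SchemeOver ℂ⦄ (f : 𝒳 ⟶ S), IsSmoothProjectiveFamily f n → g ≤ n → Even n → IrreducibleSpace S.left →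
    AlgebraicGeometry.Smooth S.hom →
    (∀ s : ComplexPoints S, ∃ A' : AbelianVariety ℂ, A'.dim = n ∧ Nonempty (A'.X ≅ fiberOver f s)) →
    ∀ (K : complexBetti 𝒳 2),
      (∀ s : ComplexPoints S, IsPolarizationClass n (fiberOver f s) (complexBetti.map (fiberι f s) 2 K)) →
    ∀ (p : ℕ), 2 ≤ p → 2 * p ≤ n → ∀ (W : complexBetti 𝒳 (2 * p)),
      (∀ s : ComplexPoints S, IsRationalClass (complexBetti.map (fiberι f s) (2 * p) W) ∧
        IsOfHodgeType n (fiberOver f s) (2 * p) p p (complexBetti.map (fiberι f s) (2 * p) W)) →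
      (∀ s : ComplexPoints S, complexBetti.map (fiberι f s) (2 * p) W ∈
        primitiveClasses (complexBetti.map (fiberι f s) 2 K) n (2 * p)) →
      (∃ s₀ : ComplexPoints S,
        complexBetti.map (fiberι f s₀) (2 * p) W ∈ algebraicClasses (fiberOver f s₀) p) →
      ∀ s : ComplexPoints S, complexBetti.map (fiberι f s) (2 * p) W ∈ algebraicClasses (fiberOver f s) p

/-- The middle-degree part's `AbelianSchemeVHCMiddleDegreeFrom[g]` (file-local notation, verbatim
`Ring2BindersAbelianSchemeVHCMiddleDegree.lean`: the cells `(2q, q)`, `2q ≥ g`, ALL fibrewise rational `(q,q)` classes). -/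
local notation3 (prettyPrint := false) "AbelianSchemeVHCMiddleDegreeFrom[" g "]" =>
  ∀ ⦃n : ℕ⦄ ⦃𝒳 S : SchemeOver ℂ⦄ (f : 𝒳 ⟶ S), IsSmoothProjectiveFamily f n → g ≤ n → IrreducibleSpace S.left →
    AlgebraicGeometry.Smooth S.hom →
    (∀ s : ComplexPoints S, ∃ A' : AbelianVariety ℂ, A'.dim = n ∧ Nonempty (A'.X ≅ fiberOver f s)) →
    ∀ (p : ℕ), 2 * p = n → ∀ (W : complexBetti 𝒳 (2 * p)),
      (∀ s : ComplexPoints S, IsRationalClass (complexBetti.map (fiberι f s) (2 * p) W) ∧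
        IsOfHodgeType n (fiberOver f s) (2 * p) p p (complexBetti.map (fiberι f s) (2 * p) W)) →
      (∃ s₀ : ComplexPoints S,
        complexBetti.map (fiberι f s₀) (2 * p) W ∈ algebraicClasses (fiberOver f s₀) p) →
      ∀ s : ComplexPoints S, complexBetti.map (fiberι f s) (2 * p) W ∈ algebraicClasses (fiberOver f s) p

/-- The rungs part's `AbelianSchemeVHCUpTo[g]` (file-local notation, verbatim: row b02 in relative dimension `n ≤ g`), consumed
by name (`abelianSchemeVHC_upTo_three`). -/
local notation3 (prettyPrint := false) "AbelianSchemeVHCUpTo[" g "]" =>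
  ∀ ⦃n : ℕ⦄ ⦃𝒳 S : SchemeOver ℂ⦄ (f : 𝒳 ⟶ S), IsSmoothProjectiveFamily f n → n ≤ g → IrreducibleSpace S.left →
    AlgebraicGeometry.Smooth S.hom →
    (∀ s : ComplexPoints S, ∃ A' : AbelianVariety ℂ, A'.dim = n ∧ Nonempty (A'.X ≅ fiberOver f s)) →
    ∀ (p : ℕ) (W : complexBetti 𝒳 (2 * p)),
      (∀ s : ComplexPoints S, IsRationalClass (complexBetti.map (fiberι f s) (2 * p) W) ∧
        IsOfHodgeType n (fiberOver f s) (2 * p) p p (complexBetti.map (fiberι f s) (2 * p) W)) →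
      (∃ s₀ : ComplexPoints S,
        complexBetti.map (fiberι f s₀) (2 * p) W ∈ algebraicClasses (fiberOver f s₀) p) →
      ∀ s : ComplexPoints S, complexBetti.map (fiberι f s) (2 * p) W ∈ algebraicClasses (fiberOver f s) p

/-- Restriction: row b02 gives its primitive-middle form (forget `K`, `2 ≤ p`, `2p = n` and primitivity). [folklore] -/
theorem abelianSchemeVHCPrimitiveMiddle_of_abelianSchemeVHC (h : AbelianSchemeVHC) : AbelianSchemeVHCPrimitiveMiddle := by
  intro n 𝒳 S f hf hirr hsm habel K _ p _ _ W hW _ h₀ s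
  exact h f hf hirr hsm habel p W hW h₀ s

/-- Restriction: the primitive-middle form gives its slice from relative dimension `g` on (forget `g ≤ n`). [folklore] -/
theorem abelianSchemeVHCPrimitiveMiddleFrom_of_primitiveMiddle (g : ℕ) (h : AbelianSchemeVHCPrimitiveMiddle) :
    AbelianSchemeVHCPrimitiveMiddleFrom[g] := by
  intro n 𝒳 S f hf _ hirr hsm habel K hK p h2 hpn W hW hP h₀ s
  exact h f hf hirr hsm habel K hK p h2 hpn W hW hP h₀ s

/-- Restriction: row b02 gives its primitive-middle form from any relative dimension `g` on. [folklore] -/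
theorem abelianSchemeVHCPrimitiveMiddleFrom_of_abelianSchemeVHC (g : ℕ) (h : AbelianSchemeVHC) :
    AbelianSchemeVHCPrimitiveMiddleFrom[g] :=
  abelianSchemeVHCPrimitiveMiddleFrom_of_primitiveMiddle g (abelianSchemeVHCPrimitiveMiddle_of_abelianSchemeVHC h)

/-- Restriction: the primitive part's deep-middle form `AbelianSchemeVHCPrimitive` gives the primitive-MIDDLE form (the cell
`2p = n` of `2p ≤ n`). [folklore] -/
theorem abelianSchemeVHCPrimitiveMiddle_of_abelianSchemeVHCPrimitive (h : AbelianSchemeVHCPrimitive) :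
    AbelianSchemeVHCPrimitiveMiddle := by
  intro n 𝒳 S f hf hirr hsm habel K hK p h2 hpn W hW hP h₀ s
  exact h f hf hirr hsm habel K hK p h2 hpn.le W hW hP h₀ s

/-- Restriction: the primitive part's `AbelianSchemeVHCPrimitiveEvenFrom[g]` gives `AbelianSchemeVHCPrimitiveMiddleFrom[g]`
(`2p = n` is even). [folklore] -/
theorem abelianSchemeVHCPrimitiveMiddleFrom_of_primitiveEvenFrom (g : ℕ) (h : AbelianSchemeVHCPrimitiveEvenFrom[g]) :
    AbelianSchemeVHCPrimitiveMiddleFrom[g] := by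
  intro n 𝒳 S f hf hgn hirr hsm habel K hK p h2 hpn W hW hP h₀ s
  exact h f hf hgn ⟨p, by omega⟩ hirr hsm habel K hK p h2 hpn.le W hW hP h₀ s

/-- Restriction: the middle-degree part's `AbelianSchemeVHCMiddleDegreeFrom[g]` (all middle classes) gives
`AbelianSchemeVHCPrimitiveMiddleFrom[g]` (primitive middle classes). [folklore] -/
theorem abelianSchemeVHCPrimitiveMiddleFrom_of_middleDegreeFrom (g : ℕ) (h : AbelianSchemeVHCMiddleDegreeFrom[g]) :
    AbelianSchemeVHCPrimitiveMiddleFrom[g] := by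
  intro n 𝒳 S f hf hgn hirr hsm habel K _ p _ hpn W hW _ h₀ s
  exact h f hf hgn hirr hsm habel p hpn W hW h₀ s

/-- **`AbelianSchemeVHCPrimitiveMiddleFrom[g] ⟹ AbelianSchemeVHCPrimitiveEvenFrom[g]`** — the primitive MIDDLE classes decide
the primitive deep-middle classes (defect `n - 2p`), FACT-FREE, on every carrier (no quasi-projectivity needed).
[cite: VoisinHodgeI2002, Cor. 6.26] [cite: Kleiman1968AlgebraicCycles, Thm. 2.9] [cite: Lieberman1968, main theorem] -/
theorem abelianSchemeVHCPrimitiveEvenFrom_of_primitiveMiddleFrom (g : ℕ) (h : AbelianSchemeVHCPrimitiveMiddleFrom[g]) :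
    AbelianSchemeVHCPrimitiveEvenFrom[g] := by
  intro n 𝒳 S f hf hgn _ hirr hsm habel K hK p h2 hpn W hW hP h₀ s
  exact map_fiberι_mem_algebraicClasses_of_primitiveMiddleFrom_of_mem_primitiveClasses h (n - 2 * p) f hf hgn hirr hsm habel
    K hK p h2 (by omega) W hW hP h₀ s

/-- **`AbelianSchemeVHCPrimitiveMiddle ⟹ AbelianSchemeVHCPrimitive`** (any relative dimension, any defect), FACT-FREE.
[cite: VoisinHodgeI2002, Cor. 6.26] [cite: Kleiman1968AlgebraicCycles, Thm. 2.9] [cite: Lieberman1968, main theorem] -/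
theorem abelianSchemeVHCPrimitive_of_primitiveMiddle (h : AbelianSchemeVHCPrimitiveMiddle) : AbelianSchemeVHCPrimitive := by
  intro n 𝒳 S f hf hirr hsm habel K hK p h2 hpn W hW hP h₀ s
  exact map_fiberι_mem_algebraicClasses_of_primitiveMiddleFrom_of_mem_primitiveClasses
    (abelianSchemeVHCPrimitiveMiddleFrom_of_primitiveMiddle 0 h) (n - 2 * p) f hf (Nat.zero_le n) hirr hsm habel K hK p h2
    (by omega) W hW hP h₀ s

/-- **The primitive-middle form from relative dimension `g` on gives the conclusion of row b02 on EVERY carrier of relative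
dimension `n ≥ g` with quasi-projective total space over a smooth irreducible quasi-projective base, in every codimension —
FACT-FREE** (§2 composed with the primitive part's `map_fiberι_mem_algebraicClasses_of_abelianSchemeVHCPrimitiveEvenFrom`:
shadow above the middle, padding below it, the global first Lefschetz step inside a degree, and now the defect induction
inside the primitive part). [cite: CharlesSchnell2014Notes, Conj. 11.3.1 and Prop. 11.3.11 (proof)] [cite: VoisinHodgeII2003, Thm. 4.18]
[cite: KerrPearlstein2011, §3.1] [cite: Lieberman1968, main theorem] -/
theorem map_fiberι_mem_algebraicClasses_of_abelianSchemeVHCPrimitiveMiddleFrom {g : ℕ}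
    (h : AbelianSchemeVHCPrimitiveMiddleFrom[g]) (f : 𝒳 ⟶ S) {n : ℕ} (hf : IsSmoothProjectiveFamily f n) (hgn : g ≤ n)
    (h𝒳 : IsQuasiProjectiveOver 𝒳) (hS : IsQuasiProjectiveOver S) [IrreducibleSpace S.left]
    (hSs : AlgebraicGeometry.Smooth S.hom)
    (hA : ∀ s : ComplexPoints S, ∃ A' : AbelianVariety ℂ, A'.dim = n ∧ Nonempty (A'.X ≅ fiberOver f s))
    (p : ℕ) (W : complexBetti 𝒳 (2 * p))
    (hW : ∀ s : ComplexPoints S, IsRationalClass (complexBetti.map (fiberι f s) (2 * p) W) ∧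
      IsOfHodgeType n (fiberOver f s) (2 * p) p p (complexBetti.map (fiberι f s) (2 * p) W))
    {s₀ : ComplexPoints S} (h₀ : complexBetti.map (fiberι f s₀) (2 * p) W ∈ algebraicClasses (fiberOver f s₀) p)
    (s : ComplexPoints S) : complexBetti.map (fiberι f s) (2 * p) W ∈ algebraicClasses (fiberOver f s) p :=
  map_fiberι_mem_algebraicClasses_of_abelianSchemeVHCPrimitiveEvenFrom
    (abelianSchemeVHCPrimitiveEvenFrom_of_primitiveMiddleFrom g h) f hf hgn h𝒳 hS hSs hA p W hW h₀ s

/-- **GLUING, fact-free: a dimension slice `n ≤ g` and the primitive-middle form from `g + 1` on give the germ form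
`OneParameterAbelianSchemeVHCGerm`.** [cite: CharlesSchnell2014Notes, Conj. 11.3.1] [cite: KerrPearlstein2011, §3.1] -/
theorem oneParameterAbelianSchemeVHCGerm_of_upTo_of_primitiveMiddleFrom {g : ℕ} (h₁ : AbelianSchemeVHCUpTo[g])
    (h₂ : AbelianSchemeVHCPrimitiveMiddleFrom[g + 1]) : OneParameterAbelianSchemeVHCGerm :=
  oneParameterAbelianSchemeVHCGerm_of_upTo_of_primitiveEvenFrom h₁ (abelianSchemeVHCPrimitiveEvenFrom_of_primitiveMiddleFrom _ h₂)

/-- **The primitive-middle form gives the germ form — FACT-FREE** (slices `n ≤ 3`: the rungs' `abelianSchemeVHC_upTo_three`).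
[cite: CharlesSchnell2014Notes, Conj. 11.3.1] [cite: VoisinHodgeII2003, §10.2.3 proof of Prop. 10.26] -/
theorem oneParameterAbelianSchemeVHCGerm_of_abelianSchemeVHCPrimitiveMiddle (h : AbelianSchemeVHCPrimitiveMiddle) :
    OneParameterAbelianSchemeVHCGerm :=
  oneParameterAbelianSchemeVHCGerm_of_upTo_of_primitiveMiddleFrom abelianSchemeVHC_upTo_three
    (abelianSchemeVHCPrimitiveMiddleFrom_of_primitiveMiddle 4 h)

/-! ## §2 The binder: row b02 IS its primitive-middle form, modulo the print residual -/

/-- **`HCUpToDim g ⟹ (row b02 ⟺ its primitive-middle form from relative dimension `g + 1` on)`**, modulo the curve print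
residual N97 (`OneParameterAbelianSchemeQuasiProjective`, used in `←`). [cite: CharlesSchnell2014Notes, Cor. 11.3.6 and Prop. 11.3.11 (proof)]
[cite: KerrPearlstein2011, §3.1] [cite: GortzWedhorn2023, Thm. 27.291] -/
theorem abelianSchemeVHC_iff_primitiveMiddleFrom_of_hcUpToDim (hqp : OneParameterAbelianSchemeQuasiProjective) {g : ℕ}
    (h : HCUpToDim g) : AbelianSchemeVHC ↔ AbelianSchemeVHCPrimitiveMiddleFrom[g + 1] :=
  ⟨abelianSchemeVHCPrimitiveMiddleFrom_of_abelianSchemeVHC (g + 1), fun h₂ ↦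
    (abelianSchemeVHC_iff_primitiveEvenFrom_of_hcUpToDim hqp h).2 (abelianSchemeVHCPrimitiveEvenFrom_of_primitiveMiddleFrom _ h₂)⟩

/-- **EXACTNESS modulo the curve print residual: row b02 `AbelianSchemeVHC` ⟺ the variational Hodge conjecture for fibrewise
LEFSCHETZ-PRIMITIVE classes of the MIDDLE degree on abelian schemes of even relative dimension `n = 2p ≥ 4`** (first cell:
abelian fourfold families, `p = 2`, `W| ∈ P⁴(𝒳_s) = ker (L : H⁴ → H⁶)`; then `(6, 3)` with `W| ∈ P⁶ = ker (L : H⁶ → H⁸)`, …).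
Granted only N97 (in `←`). [cite: CharlesSchnell2014Notes, Conj. 11.3.1 and Prop. 11.3.11 (proof)] [cite: VoisinHodgeI2002, Def. 6.24,
Thm. 6.25, Cor. 6.26] [cite: KerrPearlstein2011, §3.1] [cite: GortzWedhorn2023, Thm. 27.291] -/
theorem abelianSchemeVHC_iff_primitiveMiddleFrom_four_of_oneParameterAbelianSchemeQuasiProjective
    (hqp : OneParameterAbelianSchemeQuasiProjective) : AbelianSchemeVHC ↔ AbelianSchemeVHCPrimitiveMiddleFrom[4] :=
  ⟨abelianSchemeVHCPrimitiveMiddleFrom_of_abelianSchemeVHC 4, fun h₂ ↦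
    (abelianSchemeVHC_iff_germ_of_oneParameterAbelianSchemeQuasiProjective hqp).2
      (oneParameterAbelianSchemeVHCGerm_of_upTo_of_primitiveMiddleFrom abelianSchemeVHC_upTo_three h₂)⟩

/-- **The same modulo Raynaud's theorem as booked (`raynaud1970_abelianScheme_section_projective`, c20): row b02 ⟺ its
primitive-middle form from relative dimension `4` on.** CONDITIONAL on the named fact (used in `←` only).
[cite: GortzWedhorn2023, §(27.53) Thm. 27.291] [cite: LaurentSchroer2023, §4 Prop. 4.3] [cite: KerrPearlstein2011, §3.1] -/
theorem abelianSchemeVHC_iff_primitiveMiddleFrom_four_of_raynaud1970 (hR : raynaud1970_abelianScheme_section_projective) :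
    AbelianSchemeVHC ↔ AbelianSchemeVHCPrimitiveMiddleFrom[4] :=
  abelianSchemeVHC_iff_primitiveMiddleFrom_four_of_oneParameterAbelianSchemeQuasiProjective
    (oneParameterAbelianSchemeQuasiProjective_of_raynaud1970 hR)

/-- **Row b02 ⟺ `AbelianSchemeVHCPrimitiveMiddle`** (every even relative dimension) modulo Raynaud (c20, in `←`).
[cite: GortzWedhorn2023, Thm. 27.291] [cite: KerrPearlstein2011, §3.1] [cite: VoisinHodgeI2002, Cor. 6.26] -/
theorem abelianSchemeVHC_iff_primitiveMiddle_of_raynaud1970 (hR : raynaud1970_abelianScheme_section_projective) :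
    AbelianSchemeVHC ↔ AbelianSchemeVHCPrimitiveMiddle :=
  ⟨abelianSchemeVHCPrimitiveMiddle_of_abelianSchemeVHC, fun h ↦ (abelianSchemeVHC_iff_primitiveMiddleFrom_four_of_raynaud1970 hR).2
    (abelianSchemeVHCPrimitiveMiddleFrom_of_primitiveMiddle 4 h)⟩

/-- **The two earlier normal forms meet**: modulo Raynaud (c20), row b02, its DIAGONAL form `AbelianSchemeVHCMiddleDegreeFrom[4]`
(all middle classes, p249658), its PRIMITIVE deep-middle form `AbelianSchemeVHCPrimitiveEvenFrom[4]` (p251474) and their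
intersection `AbelianSchemeVHCPrimitiveMiddleFrom[4]` are pairwise equivalent; the two implications INTO the intersection are
fact-free restrictions. [cite: BrosnanFangNiePearlstein2009, §6 Lemma 48] [cite: VoisinHodgeI2002, Cor. 6.26] [cite: GortzWedhorn2023, Thm. 27.291] -/
theorem abelianSchemeVHCMiddleDegreeFrom_four_iff_primitiveMiddleFrom_four_of_raynaud1970
    (hR : raynaud1970_abelianScheme_section_projective) :
    (AbelianSchemeVHCMiddleDegreeFrom[4] ↔ AbelianSchemeVHCPrimitiveMiddleFrom[4]) ∧
      (AbelianSchemeVHCPrimitiveEvenFrom[4] ↔ AbelianSchemeVHCPrimitiveMiddleFrom[4]) :=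
  ⟨⟨abelianSchemeVHCPrimitiveMiddleFrom_of_middleDegreeFrom 4, fun h ↦ abelianSchemeVHCMiddleDegreeFrom_of_abelianSchemeVHC 4
      ((abelianSchemeVHC_iff_primitiveMiddleFrom_four_of_raynaud1970 hR).2 h)⟩,
    ⟨abelianSchemeVHCPrimitiveMiddleFrom_of_primitiveEvenFrom 4, abelianSchemeVHCPrimitiveEvenFrom_of_primitiveMiddleFrom 4⟩⟩

/-- **Modulo Raynaud (c20), Markman's Weil-fourfold claim (c28) and Moonen–Zarhin (c9), row b02 IS its primitive-middle form from
relative dimension `6` on**: first cell `(6, 3)`, classes `W` with `W|_{𝒳_s} ∈ P⁶(𝒳_s, K|) = ker (L_{K|} : H⁶ → H⁸)` along families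
of abelian SIXFOLDS. All three inputs displayed as hypotheses. [cite: MoonenZarhin1999LowDim, Thms. 0.1–0.2]
[cite: Markman2025SecantWeil, Cor. 1.6.1 (unrefereed)] [cite: GortzWedhorn2023, Thm. 27.291] [cite: KerrPearlstein2011, §3.1] -/
theorem abelianSchemeVHC_iff_primitiveMiddleFrom_six_of_weilClassesFourfolds_of_moonenZarhin_of_raynaud1970
    (hR : raynaud1970_abelianScheme_section_projective) (hW : Markman2025_weilClasses_algebraic_abelianFourfold)
    (hMZ : MoonenZarhin1999_hodgeClasses_abelian_dim_le_five_of_weilClassesFourfolds) :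
    AbelianSchemeVHC ↔ AbelianSchemeVHCPrimitiveMiddleFrom[6] :=
  abelianSchemeVHC_iff_primitiveMiddleFrom_of_hcUpToDim (oneParameterAbelianSchemeQuasiProjective_of_raynaud1970 hR)
    (hcUpToDim_five_of_weilClassesFourfolds_of_moonenZarhin hW hMZ)

/-- The same granted the support item `HodgeAbelianDimLeFive` of route `SevenfoldWeilCensus` (stmt-HodgeConjecture-18723) by name,
modulo Raynaud (c20). [cite: Markman2025SurveySecant, Cor. 1.3 (unrefereed)] [cite: GortzWedhorn2023, Thm. 27.291] -/
theorem abelianSchemeVHC_iff_primitiveMiddleFrom_six_of_hodgeAbelianDimLeFive_of_raynaud1970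
    (hR : raynaud1970_abelianScheme_section_projective) (h₅ : Theses.SevenfoldWeilCensus.HodgeAbelianDimLeFive) :
    AbelianSchemeVHC ↔ AbelianSchemeVHCPrimitiveMiddleFrom[6] :=
  abelianSchemeVHC_iff_primitiveMiddleFrom_of_hcUpToDim (oneParameterAbelianSchemeQuasiProjective_of_raynaud1970 hR)
    (hcUpToDim_five_iff_hodgeAbelianDimLeFive.mpr h₅)

/-- **`HC_AV` ⟺ the primitive-middle form of row b02 from relative dimension `4` on**, modulo André 1996 #21/#22 (c11, c12) and
Raynaud (c20): deform IV's (E₂′) `Deform.HC_AV_iff_abelianSchemeVHC_of_andre1996` composed with §3. No `HC_CM`.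
[cite: Andre1996Motifs, §6.3 Lemmes 6.3.1–6.3.3] [cite: KerrPearlstein2011, §3.1] [cite: Lieberman1968, main theorem] -/
theorem hc_av_iff_abelianSchemeVHCPrimitiveMiddleFrom_four_of_andre1996_of_raynaud1970
    (h₂₁ : andre1996_cmAnchoredPencil) (h₂₂ : andre1996_cmHodgeClasses_algebraicallyAnchoredPencils)
    (hR : raynaud1970_abelianScheme_section_projective) :
    Theses.PadicSemiregularLift.HodgeAbelianVarieties ↔ AbelianSchemeVHCPrimitiveMiddleFrom[4] :=
  (Deform.HC_AV_iff_abelianSchemeVHC_of_andre1996 h₂₁ h₂₂).trans (abelianSchemeVHC_iff_primitiveMiddleFrom_four_of_raynaud1970 hR)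

end Binder

/-! ## Audit: what the kernel now says about row b02

`AbelianSchemeVHCPrimitiveMiddleFrom[g] → AbelianSchemeVHCPrimitiveEvenFrom[g]` (every carrier), `→` row b02 on quasi-projective
carriers of relative dimension `≥ g`, `AbelianSchemeVHCPrimitiveMiddle → AbelianSchemeVHCPrimitive → OneParameterAbelianSchemeVHCGerm`
FACT-FREE (§2); `AbelianSchemeVHC ↔ AbelianSchemeVHCPrimitiveMiddle ↔ AbelianSchemeVHCPrimitiveMiddleFrom[4]` modulo N97 / c20
displayed as hypotheses (§3); `HC_CM` does not occur; route items and the facts c9, c11, c12, c28 enter by name as hypotheses only.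
Closures below are the three standard axioms. -/

#print axioms Summit.HodgeConjecture.HodgeConjecture.Ring2.Binders.exists_primitiveOneStepLift
#print axioms Summit.HodgeConjecture.HodgeConjecture.Ring2.Binders.map_fiberι_mem_algebraicClasses_of_primitiveMiddleFrom_of_mem_primitiveClasses
#print axioms Summit.HodgeConjecture.HodgeConjecture.Ring2.Binders.abelianSchemeVHCPrimitive_of_primitiveMiddle
#print axioms Summit.HodgeConjecture.HodgeConjecture.Ring2.Binders.abelianSchemeVHC_iff_primitiveMiddleFrom_four_of_raynaud1970
#print axioms Summit.HodgeConjecture.HodgeConjecture.Ring2.Binders.hc_av_iff_abelianSchemeVHCPrimitiveMiddleFrom_four_of_andre1996_of_raynaud1970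

end Summit.HodgeConjecture.HodgeConjecture.Ring2.Binders

end
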